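import Summits.Ventures.HodgeRepro2.T5FockInvariants

/-!
# T5FockWeights — the torus weights of `Q^k` and the `U(3)`-invariance of `Q` on the Fock model,
kernel-checked

Support for `route/T5-N4-p5.md` (sub-step N4.3 = (R3)), step (N4.3.P2-bis): «`U(3)` acts on the
polynomial Fock space `ℂ[w_{i,1}, w_{i,2}]_{i ≤ 3}` through `std*` on the first column and `std` on
the second; the `U(3)`-invariants are the polynomials in `Q := Σ_i w_{i,1} w_{i,2}`; the
`K_W`-weight of `Q^k` is `((m′+3)/2 + k, (m′−3)/2 − k)` because `U(1)_{W+}` acts on each `w_{i,1}`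
with weight `+1` and `U(1)_{W−}` on each `w_{i,2}` with weight `−1`».  Two of its sentences are
elementary polynomial algebra, formalised here on `T5FockInvariants.Q` (the same `Q`):

* `torusAct c` — the `ℂ`-algebra endomorphism `w_{i,1} ↦ c 0 · w_{i,1}`, `w_{i,2} ↦ c 1 · w_{i,2}`;
  `torusAct_Q_pow`: `Q^k ↦ (c 0 · c 1)^k · Q^k`, i.e. with `c = (z₁, z₂⁻¹)` the weight `(k, −k)`
  (the constant shift `((m′+3)/2, (m′−3)/2)` of the vacuum is the scalar of `Lemma 5.2(i)`, recorded
  in `T5FockInvariants.ktype_match` / `T5SEArithmetic`);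
* `unitaryAct u` — `w_{i,1} ↦ Σ_j conj(u_{ji}) w_{j,1}` (`std*`), `w_{i,2} ↦ Σ_j u_{ji} w_{j,2}`
  (`std`); `unitaryAct_Q`: `Q` is fixed by every `u` with `u uᴴ = 1` — the EASY half of the first
  fundamental theorem «`U(3)`-invariants = `ℂ[Q]`» (R3.7, [C]); the hard half (nothing else is
  invariant) is NOT formalised.

Honest scope: the Weil representation and [KK07] Lemma 5.2(i) themselves are not modelled; the
statements here are about the polynomial ring only.
-/

noncomputable section

namespace Summit.Ventures.HodgeRepro2.T5FockWeights

open MvPolynomial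
open scoped Matrix
open Summit.Ventures.HodgeRepro2.T5FockInvariants

/-- The torus `K_W = U(1) × U(1)` on the Fock variables: `w_{i,1} ↦ c 0 · w_{i,1}`,
`w_{i,2} ↦ c 1 · w_{i,2}`, as a `ℂ`-algebra endomorphism of the polynomial ring. -/
def torusAct (c : Fin 2 → ℂ) : MvPolynomial Var ℂ →ₐ[ℂ] MvPolynomial Var ℂ :=
  aeval (fun p : Var => C (c p.2) * X p)

/-- `torusAct c (X p) = c p.2 · X p`. -/
theorem torusAct_X (c : Fin 2 → ℂ) (p : Var) : torusAct c (X p) = C (c p.2) * X p := by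
  simp [torusAct]

/-- `Q` has torus weight `c 0 · c 1`. -/
theorem torusAct_Q (c : Fin 2 → ℂ) : torusAct c Q = C (c 0 * c 1) * Q := by
  simp only [Q, map_sum, map_mul, torusAct_X]
  rw [Finset.mul_sum]
  refine Finset.sum_congr rfl (fun i _ => ?_)
  ring

/-- `Q^k` has torus weight `(c 0 · c 1)^k`: with `c = (z₁, z₂⁻¹)` this is the weight `(k, −k)` of
(N4.3.P2-bis). -/
theorem torusAct_Q_pow (c : Fin 2 → ℂ) (k : ℕ) :
    torusAct c (Q ^ k) = C ((c 0 * c 1) ^ k) * Q ^ k := by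
  rw [map_pow, torusAct_Q, mul_pow, map_pow]

/-- The action of `u ∈ M₃(ℂ)` on the Fock variables: `std*` on the first column
(`w_{i,1} ↦ Σ_j conj(u_{ji}) w_{j,1}`) and `std` on the second (`w_{i,2} ↦ Σ_j u_{ji} w_{j,2}`). -/
def unitaryAct (u : Matrix (Fin 3) (Fin 3) ℂ) : MvPolynomial Var ℂ →ₐ[ℂ] MvPolynomial Var ℂ :=
  aeval (fun p : Var =>
    if p.2 = 0 then ∑ j, C (star (u j p.1)) * X (j, 0) else ∑ j, C (u j p.1) * X (j, 1))

/-- The first column transforms by `std*`. -/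
theorem unitaryAct_X0 (u : Matrix (Fin 3) (Fin 3) ℂ) (i : Fin 3) :
    unitaryAct u (X (i, 0)) = ∑ j, C (star (u j i)) * X (j, 0) := by
  simp [unitaryAct]

/-- The second column transforms by `std`. -/
theorem unitaryAct_X1 (u : Matrix (Fin 3) (Fin 3) ℂ) (i : Fin 3) :
    unitaryAct u (X (i, 1)) = ∑ j, C (u j i) * X (j, 1) := by
  simp [unitaryAct]

/-- The orthogonality relation `Σ_i conj(u_{ji}) u_{ki} = δ_{jk}` of a unitary `u`. -/
theorem sum_star_mul_of_unitary (u : Matrix (Fin 3) (Fin 3) ℂ) (hu : u * uᴴ = 1) (j k : Fin 3) :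
    ∑ i, star (u j i) * u k i = if j = k then 1 else 0 := by
  have h := congrFun (congrFun hu k) j
  rw [Matrix.mul_apply, Matrix.one_apply] at h
  simp only [Matrix.conjTranspose_apply] at h
  rw [show (if j = k then (1 : ℂ) else 0) = if k = j then 1 else 0 by simp [eq_comm], ← h]
  exact Finset.sum_congr rfl (fun i _ => mul_comm _ _)

/-- `Q` IS `U(3)`-INVARIANT — the easy half of «`U(3)`-invariants = `ℂ[Q]`» (R3.7): for `u uᴴ = 1`,
`unitaryAct u Q = Q`. -/
theorem unitaryAct_Q (u : Matrix (Fin 3) (Fin 3) ℂ) (hu : u * uᴴ = 1) : unitaryAct u Q = Q := by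
  simp only [Q, map_sum, map_mul, unitaryAct_X0, unitaryAct_X1]
  calc ∑ i, (∑ j, C (star (u j i)) * X ((j, 0) : Var)) * (∑ k, C (u k i) * X ((k, 1) : Var))
      = ∑ i, ∑ j, ∑ k, C (star (u j i) * u k i) * (X ((j, 0) : Var) * X ((k, 1) : Var)) := by
        refine Finset.sum_congr rfl (fun i _ => ?_)
        rw [Finset.sum_mul_sum]
        refine Finset.sum_congr rfl (fun j _ => Finset.sum_congr rfl (fun k _ => ?_))
        rw [map_mul]
        ring
    _ = ∑ j, ∑ k, (∑ i, C (star (u j i) * u k i)) * (X ((j, 0) : Var) * X ((k, 1) : Var)) := by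
        rw [Finset.sum_comm]
        refine Finset.sum_congr rfl (fun j _ => ?_)
        rw [Finset.sum_comm]
        refine Finset.sum_congr rfl (fun k _ => ?_)
        rw [Finset.sum_mul]
    _ = ∑ j, ∑ k, (if j = k then (1 : MvPolynomial Var ℂ) else 0) * (X ((j, 0) : Var) * X ((k, 1) : Var)) := by
        refine Finset.sum_congr rfl (fun j _ => Finset.sum_congr rfl (fun k _ => ?_))
        rw [← map_sum, sum_star_mul_of_unitary u hu j k]
        split_ifs <;> simp
    _ = ∑ j, X ((j, 0) : Var) * X ((j, 1) : Var) := by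
        refine Finset.sum_congr rfl (fun j _ => ?_)
        simp [Finset.sum_ite_eq]

end Summit.Ventures.HodgeRepro2.T5FockWeights

end
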